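import Mathlib

/-!
# A joint eigenvector meets every orthonormal joint eigenbasis

Finite-dimensional linear algebra used by the reduction of a joint-eigenfunction witness to basis
forms: if an orthonormal basis `b` simultaneously diagonalises a family of linear maps `T p`
(`T p (b i) = ν p i • b i`) and `u ≠ 0` is a joint eigenvector (`T p u = μ p • u`), then some basis
vector `b i` has a nonzero coefficient `⟪b i, u⟫` in `u`, and every such index carries the same
eigenvalues: `ν p i = μ p` for all `p`.  The proof compares the `i`-th coordinate of `T p u`
computed from the eigen-equation (`μ p * ⟪b i, u⟫`) and from the expansion
`u = ∑ j, ⟪b j, u⟫ • b j` (`ν p i * ⟪b i, u⟫`) and cancels the nonzero scalar. [folklore]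
-/

set_option linter.dupNamespace false

namespace Summit.Langlands.Langlands.Theorems.QuarterFingerprintDeficit

/-- Coordinate identity: if an orthonormal basis `b` diagonalises a linear map `T` with
eigenvalues `ν` (`T (b i) = ν i • b i`), then the `i`-th coordinate of `T u` is `ν i` times the
`i`-th coordinate of `u`: `⟪b i, T u⟫ = ν i * ⟪b i, u⟫`. [folklore] -/
theorem inner_basis_apply_eq_mul_inner {𝕜 E ι : Type*} [RCLike 𝕜] [NormedAddCommGroup E]
    [InnerProductSpace 𝕜 E] [Fintype ι] (b : OrthonormalBasis ι 𝕜 E) (T : E →ₗ[𝕜] E)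
    (ν : ι → 𝕜) (hb : ∀ i, T (b i) = ν i • b i) (u : E) (i : ι) :
    inner 𝕜 (b i) (T u) = ν i * inner 𝕜 (b i) u := by
  classical
  conv_lhs => rw [← b.sum_repr' u]
  rw [map_sum, inner_sum]
  simp_rw [LinearMap.map_smul, hb, inner_smul_right, b.inner_eq_ite, mul_ite, mul_one, mul_zero,
    Finset.sum_ite_eq, Finset.mem_univ, if_true]
  exact mul_comm _ _

/-- A nonzero joint eigenvector `u` of a family `T p` of linear maps that is simultaneously
diagonalised by an orthonormal basis `b` (`T p (b i) = ν p i • b i`) has a nonzero coefficient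
on some basis vector `b i`, and that basis vector has the same eigenvalues as `u` for every `p`.
[folklore] -/
theorem stub_jointEigenvectorMeetsBasis {𝕜 E ι P : Type*} [RCLike 𝕜] [NormedAddCommGroup E]
    [InnerProductSpace 𝕜 E] [Fintype ι] (b : OrthonormalBasis ι 𝕜 E) (T : P → E →ₗ[𝕜] E)
    (ν : P → ι → 𝕜) (hb : ∀ p i, T p (b i) = ν p i • b i) (u : E) (hu : u ≠ 0) (μ : P → 𝕜)
    (hTu : ∀ p, T p u = μ p • u) :
    ∃ i, inner 𝕜 (b i) u ≠ 0 ∧ ∀ p, ν p i = μ p := by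
  -- some coordinate of the nonzero vector `u` is nonzero
  obtain ⟨i, hi⟩ : ∃ i, inner 𝕜 (b i) u ≠ 0 := by
    by_contra h
    push Not at h
    apply hu
    rw [← b.sum_repr' u]
    simp [h]
  refine ⟨i, hi, fun p => ?_⟩
  -- the `i`-th coordinate of `T p u`, computed two ways
  have h1 : inner 𝕜 (b i) (T p u) = μ p * inner 𝕜 (b i) u := by
    rw [hTu, inner_smul_right]
  have h2 : inner 𝕜 (b i) (T p u) = ν p i * inner 𝕜 (b i) u :=
    inner_basis_apply_eq_mul_inner b (T p) (ν p) (hb p) u i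
  exact mul_right_cancel₀ hi (h2.symm.trans h1)

end Summit.Langlands.Langlands.Theorems.QuarterFingerprintDeficit
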